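import Literature.RingTheory.DiscreteValuationRing.PrimeElementLocalization
import Mathlib.RingTheory.Localization.Away.Basic
import Mathlib.RingTheory.Multiplicity
import HarnessLib

/-!
# Units of `A[1/p]` which lie in `A`, for a prime element `p` of a domain

Topic `RingTheory/Localization` (proofs only; no definitions, no named facts). Let `A` be an
integral domain and `p ∈ A` a prime element. The units of the localisation `A[1/p]` that come
from `A` are exactly the elements `pᵐ·u` with `u ∈ Aˣ`, as soon as `p`-multiplicities are finite
(e.g. `A` noetherian):

* (private) `isUnit_of_mul_eq_prime_pow` — if `g·h = pᴺ` and `p ∤ g` then `g` is a unit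
  (induction on `N`, primality of `p`);
* `exists_eq_pow_mul_unit_of_isUnit_away` — if `a ∈ A` has finite `p`-multiplicity and becomes a
  unit in `A[1/p]` (any `IsLocalization.Away p S`), then `a = pᵐ·u` with `u ∈ Aˣ`;
* `exists_eq_pow_mul_unit_of_isUnit_away'` — the same with the finiteness supplied by
  `WfDvdMonoid A` (e.g. `A` noetherian) when `p` is not a unit.

This is the one-component case of «the divisor of a rational section that generates on the
generic fibre is vertical»: for a smooth scheme over a discrete valuation ring `R` with
uniformizer `ϖ` and irreducible special fibre, `ϖ` is a prime element of the local rings, and a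
function invertible on the generic fibre is `ϖᵐ·(unit)` locally (Edixhoven–Romagny,
*Group schemes out of birational group laws, Néron models*, §6, Lemma before Thm. 6.3, where it is
obtained from normality; Bosch–Lütkebohmert–Raynaud, *Néron Models*, §4.3). Cell
`hodgecm-mathlib`, road W of `r₀` (leaf L2 of (W0)).

## Sources

* B. Edixhoven, M. Romagny, *Group schemes out of birational group laws, Néron models*,
  arXiv:1204.1799v2, §6 (Lemma before Thm. 6.3). [EdixhovenRomagny2012]
* N. Bourbaki, *Commutative Algebra*, Ch. VI §1 (prime elements and localisation). [Bourbaki1989CommAlg]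
-/

noncomputable section

namespace Literature.RingTheory.Localization

variable {A : Type*} [CommRing A] [IsDomain A] {p : A}

/-- **If `g·h = pᴺ` with `p` prime and `p ∤ g`, then `g` is a unit**: by induction on `N`,
`p ∣ g·h` forces `p ∣ h`, and `p` cancels in the domain `A` (private helper of
`exists_eq_pow_mul_unit_of_isUnit_away`). [folklore] -/
private theorem isUnit_of_mul_eq_prime_pow (hp : Prime p) {g : A} (hg : ¬p ∣ g) :
    ∀ {N : ℕ} {h : A}, g * h = p ^ N → IsUnit g
  | 0, h, hN => isUnit_iff_exists_inv.mpr ⟨h, by rwa [pow_zero] at hN⟩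
  | N + 1, h, hN => by
    have hph : p ∣ h := by
      rcases hp.dvd_or_dvd (show p ∣ g * h from ⟨p ^ N, by rw [hN, pow_succ']⟩) with hg' | hh
      · exact absurd hg' hg
      · exact hh
    obtain ⟨h₁, rfl⟩ := hph
    refine isUnit_of_mul_eq_prime_pow hp hg (N := N) (h := h₁) ?_
    have h1 : p * (g * h₁) = p * p ^ N := by
      rw [← pow_succ', ← hN]; ring
    exact mul_left_cancel₀ hp.ne_zero h1

/-- **Units of `A[1/p]` lying in `A` are `pᵐ·(unit)`** (`p` prime, `S = A[1/p]` any
`IsLocalization.Away p S`): if `a ∈ A` has finite `p`-multiplicity (`∃ n, ¬ pⁿ ∣ a`) and its image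
in `A[1/p]` is a unit, then `a = pᵐ·u` with `u ∈ Aˣ`. Write `a = pᵐ·c` with `p ∤ c`
(`exists_eq_pow_mul_not_dvd`); `c` is a unit in `A[1/p]`, so `c·b = pᴺ` for some `b ∈ A`, `N`,
and `isUnit_of_mul_eq_prime_pow` applies. [cite: EdixhovenRomagny2012, §6 (Lemma before Thm. 6.3)] -/
theorem exists_eq_pow_mul_unit_of_isUnit_away (hp : Prime p) (S : Type*) [CommRing S]
    [Algebra A S] [IsLocalization.Away p S] {a : A} (hfin : ∃ n, ¬p ^ n ∣ a)
    (ha : IsUnit (algebraMap A S a)) : ∃ (m : ℕ) (u : Aˣ), a = p ^ m * u := by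
  obtain ⟨m, c, rfl, hc⟩ :=
    Literature.RingTheory.DiscreteValuationRing.exists_eq_pow_mul_not_dvd p hfin
  -- `c` is a unit in `A[1/p]`
  have hcS : IsUnit (algebraMap A S c) := by
    rw [map_mul] at ha
    exact isUnit_of_mul_isUnit_right ha
  -- hence `c · b = pᴺ` in `A` for some `b`, `N`
  obtain ⟨y, hy⟩ := hcS.exists_right_inv
  obtain ⟨⟨b, s⟩, hys⟩ := IsLocalization.surj (Submonoid.powers p) y
  obtain ⟨N, hsN⟩ := (Submonoid.mem_powers_iff _ _).mp s.2
  -- `c * b = s` in `S`, hence `pᵏ · (c * b) = pᵏ · s` in `A` for some `k`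
  have hcb : algebraMap A S (c * b) = algebraMap A S (s : A) := by
    rw [map_mul, ← hys, ← mul_assoc, hy, one_mul]
  obtain ⟨⟨k', hk'⟩, hk⟩ := (IsLocalization.eq_iff_exists (Submonoid.powers p) S).mp hcb
  obtain ⟨k, rfl⟩ := (Submonoid.mem_powers_iff _ _).mp hk'
  simp only at hk
  have hcb' : c * b = p ^ N := by
    rw [← hsN] at hk
    exact mul_left_cancel₀ (pow_ne_zero k hp.ne_zero) hk
  obtain ⟨u, hu⟩ := isUnit_of_mul_eq_prime_pow hp hc hcb'
  exact ⟨m, u, by rw [hu]⟩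

/-- **Units of `A[1/p]` lying in `A` are `pᵐ·(unit)`**, with the finiteness of the
`p`-multiplicity supplied by `WfDvdMonoid A` (e.g. `A` noetherian) for `p` prime (hence not a
unit) and `a ≠ 0`. [cite: EdixhovenRomagny2012, §6 (Lemma before Thm. 6.3)] -/
theorem exists_eq_pow_mul_unit_of_isUnit_away' [WfDvdMonoid A] (hp : Prime p) (S : Type*)
    [CommRing S] [Algebra A S] [IsLocalization.Away p S] {a : A} (ha0 : a ≠ 0)
    (ha : IsUnit (algebraMap A S a)) : ∃ (m : ℕ) (u : Aˣ), a = p ^ m * u := by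
  have hfin : FiniteMultiplicity p a := FiniteMultiplicity.of_not_isUnit hp.not_unit ha0
  obtain ⟨n, hn⟩ : ∃ n, ¬p ^ n ∣ a := by
    by_contra h
    push Not at h
    exact hfin.not_pow_dvd_of_multiplicity_lt (lt_add_one _) (h _)
  exact exists_eq_pow_mul_unit_of_isUnit_away hp S ⟨n, hn⟩ ha

/-- **An element of `A[1/p]` which is a unit is `pᵐ · u / pⁿ` with `u ∈ Aˣ`**: every unit of
`S = A[1/p]` has the form `algebraMap A S (pᵐ·u) · (algebraMap A S (pⁿ))⁻¹`, `A` a domain with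
`WfDvdMonoid A` and `p` prime. [cite: EdixhovenRomagny2012, §6 (Lemma before Thm. 6.3)] -/
theorem exists_eq_pow_mul_unit_div_pow_of_isUnit [WfDvdMonoid A] (hp : Prime p) (S : Type*)
    [CommRing S] [Algebra A S] [IsLocalization.Away p S] {x : S} (hx : IsUnit x) :
    ∃ (m n : ℕ) (u : Aˣ), x * algebraMap A S (p ^ n) = algebraMap A S (p ^ m * u) := by
  obtain ⟨⟨a, s⟩, hxs⟩ := IsLocalization.surj (Submonoid.powers p) x
  obtain ⟨n, hsn⟩ := (Submonoid.mem_powers_iff _ _).mp s.2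
  simp only at hxs
  have hpn : IsUnit (algebraMap A S (p ^ n)) := by
    rw [map_pow]; exact (IsLocalization.Away.algebraMap_isUnit (S := S) p).pow n
  have ha : IsUnit (algebraMap A S a) := by
    rw [← hxs, ← hsn]; exact hx.mul hpn
  have hinj : Function.Injective (algebraMap A S) :=
    IsLocalization.injective S (powers_le_nonZeroDivisors_of_noZeroDivisors hp.ne_zero)
  have ha0 : a ≠ 0 := by
    rintro rfl
    obtain ⟨y, hy⟩ := hx.exists_left_inv
    have h0 : algebraMap A S (p ^ n) = 0 := by
      rw [← hsn] at hxs
      rw [← one_mul (algebraMap A S (p ^ n)), ← hy, mul_assoc, hxs, map_zero, mul_zero]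
    exact pow_ne_zero n hp.ne_zero (hinj (h0.trans (map_zero _).symm))
  obtain ⟨m, u, hmu⟩ := exists_eq_pow_mul_unit_of_isUnit_away' hp S ha0 ha
  exact ⟨m, n, u, by rw [← hmu, ← hxs, hsn]⟩

end Literature.RingTheory.Localization

end
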